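import Literature.Barriers.Parity.SiegelZeroDichotomyPairHLProp81Prelim
import HarnessLib

/-!
# Tao–Teräväinen 2022, §8 (`k = 2`): the parameter choices for Propositions 7.2 and 8.1

Topic `Literature/Barriers/Parity`, sub-namespace `TaoTeravainen`; bookkeeping for the assembly of
`Literature.Barriers.Parity.TaoTeravainen2021_prop72_81_pair` (T. Tao, J. Teräväinen, *The
Hardy–Littlewood–Chowla conjecture in the presence of a Siegel zero*, J. London Math. Soc. (2) 106 (2022),
arXiv:2109.06291), §7 (7.3) "`D := x^{ε₀/20}`" (so that `log(Dq²) = ε₀X/20 + 2 log q`), §8 ("for all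
`x^{1−ε₀²} ≤ y ≤ x`", "we can restrict `d_j ≤ x exp(−log^{1−ε₀} x)`…"). With `X = log x` and
`U₀ = ε₀X/20 + 2 log q` (the arguments of `vonMangoldtSiegelFlat` in `prop72_pair`) this file fixes

* `ppDmax ε₀ q x H = ⌈(x+H) e^{2U₀+1−X}⌉` (support of `d ↦ Ψ((n+h)/d)`), `ppBmax ε₀ q x = ⌊e^{U₀+1}⌋`
  (support of the twisted coefficients), `ppx₁ ε₀ x = ⌊x^{1−ε₀²}⌋` (the bulk threshold),
  `ppL ε₀ q x = X + 2U₀ + 3` (the crude logarithmic level),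

and PROVES the structural hypotheses of `abs_sharpCorr_sub_le_of_euler` / `abs_sharpCorr_sub_smooth_le`
for `3 ≤ q`, `log q ≤ X/20`, `0 < ε₀ ≤ 1/100`, `H ≤ x`: `pp_flat` (`2 ≤ U₀`, `3U₀ ≤ X`, `2U₀+2 ≤ X`),
`pp_log_add_le` (`log(x+h) ≤ X+1`), `pp_hi`, `pp_lo` (the bulk window for `δ = 1/4`), `pp_x₁_le`,
`pp_Dmax`, `pp_divisor_log_le` (the hypothesis `hD` of the `χ`-twisted file), `pp_Bmax`, `pp_L`
(`0 ≤ L`, `log D_max ≤ L`, `log(x+h) ≤ L`), `pp_A` (`A = D_max + 1`), `pp_small` (the `ζ`-window for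
`τ₀ = X^{-9/10}`). [cite: TaoTeravainen2021, §7 (7.3) and §8 (the ranges of `y` and `d_j`)]
-/

noncomputable section

open Finset Real

namespace Literature.Barriers.Parity

namespace TaoTeravainen

/-! ### The parameters -/

/-- `U₀ = log(D q²) = ε₀ X/20 + 2 log q`. [cite: TaoTeravainen2021, §7 (7.3)] -/
def ppU (ε₀ : ℝ) (q x : ℕ) : ℝ := ε₀ / 20 * Real.log x + 2 * Real.log q

/-- `D_max = ⌈(x + H) e^{2U₀ + 1 − X}⌉`. [cite: TaoTeravainen2021, §8] -/
def ppDmax (ε₀ : ℝ) (q x H : ℕ) : ℕ :=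
  ⌈Real.exp (Real.log ((x + H : ℕ) : ℝ) - Real.log x + 2 * ppU ε₀ q x + 1)⌉₊

/-- `B_max = ⌊e^{U₀ + 1}⌋`. [cite: TaoTeravainen2021, §7 (7.4)] -/
def ppBmax (ε₀ : ℝ) (q x : ℕ) : ℕ := ⌊Real.exp (ppU ε₀ q x + 1)⌋₊

/-- The bulk threshold `x₁ = ⌊x^{1 − ε₀²}⌋`. [cite: TaoTeravainen2021, §8 ("`x^{1−ε₀²} ≤ y ≤ x`")] -/
def ppx₁ (ε₀ : ℝ) (x : ℕ) : ℕ := ⌊(x : ℝ) ^ (1 - ε₀ ^ 2)⌋₊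

/-- The crude logarithmic level `L = X + 2U₀ + 3`. [folklore] -/
def ppL (ε₀ : ℝ) (q x : ℕ) : ℝ := Real.log x + 2 * ppU ε₀ q x + 3

section

variable {ε₀ : ℝ} {q x H : ℕ}

/-- `log 2 < 7/10` and `1 < log 3`. [folklore] -/
theorem log_two_lt_and_one_lt_log_three : Real.log 2 < 7 / 10 ∧ 1 < Real.log 3 := by
  constructor
  · have := Real.log_two_lt_d9; linarith
  · rw [← Real.log_exp 1]
    refine Real.log_lt_log (Real.exp_pos 1) ?_
    have := Real.exp_one_lt_d9; linarith

/-- **The flat scale is admissible**: `2 ≤ U₀`, `3U₀ ≤ X`, `2U₀ + 2 ≤ X` (`X = log x ≥ 20`,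
`log q ≤ X/20`, `3 ≤ q`, `0 < ε₀ ≤ 1/100`). [cite: TaoTeravainen2021, §7 (7.3)] -/
theorem pp_flat (hX : 20 ≤ Real.log x) (hq : 3 ≤ q) (hlogq : Real.log q ≤ Real.log x / 20)
    (hε₀ : 0 < ε₀) (hε₀1 : ε₀ ≤ 1 / 100) :
    2 ≤ ppU ε₀ q x ∧ 3 * ppU ε₀ q x ≤ Real.log x ∧ 2 * ppU ε₀ q x + 2 ≤ Real.log x :=
  flatParams hX hq hlogq hε₀ hε₀1

/-- `log(x + h) ≤ X + 1` for `h ≤ x`, `1 ≤ x`. [folklore] -/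
theorem pp_log_add_le {h : ℕ} (hx : 1 ≤ x) (hh : h ≤ x) : Real.log ((x + h : ℕ) : ℝ) ≤ Real.log x + 1 := by
  have hx0 : (0 : ℝ) < x := by exact_mod_cast hx
  have hhx : (h : ℝ) ≤ x := by exact_mod_cast hh
  have h2 : ((x + h : ℕ) : ℝ) ≤ 2 * x := by push_cast; linarith
  calc Real.log ((x + h : ℕ) : ℝ) ≤ Real.log (2 * x) := Real.log_le_log (by positivity) h2
    _ = Real.log 2 + Real.log x := Real.log_mul two_ne_zero hx0.ne'
    _ ≤ Real.log x + 1 := by have := log_two_lt_and_one_lt_log_three.1; linarith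

/-- **The upper bulk condition**: `log(x+h) + 1/4 ≤ X + U₀ − 1` (`U₀ ≥ 2`, `h ≤ x`). [folklore] -/
theorem pp_hi {h : ℕ} (hx : 1 ≤ x) (hh : h ≤ x) (hU : 2 ≤ ppU ε₀ q x) :
    Real.log ((x + h : ℕ) : ℝ) + 1 / 4 ≤ Real.log x + ppU ε₀ q x - 1 := by
  have hx0 : (0 : ℝ) < x := by exact_mod_cast hx
  have hhx : (h : ℝ) ≤ x := by exact_mod_cast hh
  have h2 : ((x + h : ℕ) : ℝ) ≤ 2 * x := by push_cast; linarith
  have : Real.log ((x + h : ℕ) : ℝ) ≤ Real.log 2 + Real.log x := by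
    calc Real.log ((x + h : ℕ) : ℝ) ≤ Real.log (2 * x) := Real.log_le_log (by positivity) h2
      _ = Real.log 2 + Real.log x := Real.log_mul two_ne_zero hx0.ne'
  have := log_two_lt_and_one_lt_log_three.1
  linarith

/-- `x₁ ≤ x`. [folklore] -/
theorem pp_x₁_le (hx : 1 ≤ x) : ppx₁ ε₀ x ≤ x := by
  unfold ppx₁
  refine Nat.floor_le_of_le ?_
  have hx1 : (1 : ℝ) ≤ x := by exact_mod_cast hx
  calc (x : ℝ) ^ (1 - ε₀ ^ 2) ≤ (x : ℝ) ^ (1 : ℝ) := Real.rpow_le_rpow_of_exponent_le hx1 (by nlinarith)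
    _ = x := Real.rpow_one _

/-- **The lower bulk condition**: `X − U₀ + 1 + 1/4 ≤ log(x₁ + 1)` (`3 ≤ q`, `0 < ε₀ ≤ 1/20`, `1 ≤ x`).
[cite: TaoTeravainen2021, §8 ("for all `x^{1−ε₀²} ≤ y ≤ x`")] -/
theorem pp_lo (hx : 1 ≤ x) (hq : 3 ≤ q) (hε₀ : 0 < ε₀) (hε₀1 : ε₀ ≤ 1 / 20) :
    Real.log x - ppU ε₀ q x + 1 + 1 / 4 ≤ Real.log ((ppx₁ ε₀ x + 1 : ℕ) : ℝ) := by
  have hx0 : (0 : ℝ) < x := by exact_mod_cast hx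
  have hX0 : 0 ≤ Real.log x := Real.log_nonneg (by exact_mod_cast hx)
  have hpow : (x : ℝ) ^ (1 - ε₀ ^ 2) ≤ ((ppx₁ ε₀ x + 1 : ℕ) : ℝ) := by
    unfold ppx₁; push_cast; exact (Nat.lt_floor_add_one _).le
  have hlog : (1 - ε₀ ^ 2) * Real.log x ≤ Real.log ((ppx₁ ε₀ x + 1 : ℕ) : ℝ) := by
    rw [← Real.log_rpow hx0]
    exact Real.log_le_log (Real.rpow_pos_of_pos hx0 _) hpow
  have hlog3 : 1 ≤ Real.log q := by
    have h3 : Real.log 3 ≤ Real.log q := Real.log_le_log (by norm_num) (by exact_mod_cast hq)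
    have := log_two_lt_and_one_lt_log_three.2; linarith
  unfold ppU
  have : ε₀ ^ 2 * Real.log x ≤ ε₀ / 20 * Real.log x := by
    refine mul_le_mul_of_nonneg_right ?_ hX0; nlinarith
  nlinarith

/-- **`D_max` covers the supports**: `exp(log(x+h) − X + 2U₀ + 1) ≤ D_max` for `h ≤ H`. [folklore] -/
theorem pp_Dmax {h : ℕ} (hh : h ≤ H) :
    Real.exp (Real.log ((x + h : ℕ) : ℝ) - Real.log x + 2 * ppU ε₀ q x + 1) ≤ ppDmax ε₀ q x H := by
  unfold ppDmax
  refine le_trans (Real.exp_le_exp.mpr ?_) (Nat.le_ceil _)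
  have : Real.log ((x + h : ℕ) : ℝ) ≤ Real.log ((x + H : ℕ) : ℝ) := by
    by_cases h0 : ((x + h : ℕ) : ℝ) = 0
    · rw [h0, Real.log_zero]; exact Real.log_natCast_nonneg _
    · exact Real.log_le_log (lt_of_le_of_ne (Nat.cast_nonneg _) (Ne.symm h0)) (by exact_mod_cast Nat.add_le_add_left hh x)
  linarith

/-- **The hypothesis `hD` of the `χ`-twisted file**: for `n ≤ x`, `h ≤ H`, `d ∣ n + h` with `d > D_max`,
`log((n+h)/d) ≤ X − 2U₀ − 1`. [cite: TaoTeravainen2021, §8 ("the restrictions on `d_j` can be dropped")] -/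
theorem pp_divisor_log_le {h : ℕ} (hh : h ≤ H) (hx : 1 ≤ x) {n : ℕ} (hn : n ∈ Icc 1 x) {d : ℕ}
    (hd : ppDmax ε₀ q x H < d) :
    Real.log (((n + h : ℕ) : ℝ) / d) ≤ Real.log x - 2 * ppU ε₀ q x - 1 := by
  rw [mem_Icc] at hn
  have hD := pp_Dmax (ε₀ := ε₀) (q := q) (x := x) hh
  set E := Real.exp (Real.log ((x + h : ℕ) : ℝ) - Real.log x + 2 * ppU ε₀ q x + 1) with hE
  have hEpos : 0 < E := Real.exp_pos _
  have hEd : E < d := lt_of_le_of_lt hD (by exact_mod_cast hd)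
  have hd0 : (0 : ℝ) < d := hEpos.trans hEd
  have hnh0 : (0 : ℝ) < ((n + h : ℕ) : ℝ) := by exact_mod_cast (show 0 < n + h by omega)
  have hxh0 : (0 : ℝ) < ((x + h : ℕ) : ℝ) := by exact_mod_cast (show 0 < x + h by omega)
  -- `(n+h)/d ≤ (x+h)/E = exp(X − 2U₀ − 1)`
  have hle : ((n + h : ℕ) : ℝ) / d ≤ ((x + h : ℕ) : ℝ) / E := by
    rw [div_le_div_iff₀ hd0 hEpos]
    calc ((n + h : ℕ) : ℝ) * E ≤ ((x + h : ℕ) : ℝ) * E := by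
          refine mul_le_mul_of_nonneg_right ?_ hEpos.le; exact_mod_cast (show n + h ≤ x + h by omega)
      _ ≤ ((x + h : ℕ) : ℝ) * d := mul_le_mul_of_nonneg_left hEd.le hxh0.le
  have hval : ((x + h : ℕ) : ℝ) / E = Real.exp (Real.log x - 2 * ppU ε₀ q x - 1) := by
    rw [hE, div_eq_iff hEpos.ne', ← Real.exp_add]
    have : Real.log x - 2 * ppU ε₀ q x - 1 + (Real.log ((x + h : ℕ) : ℝ) - Real.log x + 2 * ppU ε₀ q x + 1) =
        Real.log ((x + h : ℕ) : ℝ) := by ring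
    rw [this, Real.exp_log hxh0]
  calc Real.log (((n + h : ℕ) : ℝ) / d) ≤ Real.log (((x + h : ℕ) : ℝ) / E) := Real.log_le_log (by positivity) hle
    _ = Real.log x - 2 * ppU ε₀ q x - 1 := by rw [hval, Real.log_exp]

/-- **`B_max` covers the support of the twisted coefficients**: `U₀ + 1 ≤ log b` for `b > B_max`. [folklore] -/
theorem pp_Bmax {b : ℕ} (hb : ppBmax ε₀ q x < b) : ppU ε₀ q x + 1 ≤ Real.log b := by
  unfold ppBmax at hb
  have h1 : Real.exp (ppU ε₀ q x + 1) < b := by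
    have := Nat.lt_floor_add_one (Real.exp (ppU ε₀ q x + 1))
    have hb' : (⌊Real.exp (ppU ε₀ q x + 1)⌋₊ : ℝ) + 1 ≤ b := by exact_mod_cast hb
    linarith
  have hb0 : (0 : ℝ) < b := (Real.exp_pos _).trans h1
  rw [← Real.log_exp (ppU ε₀ q x + 1)]
  exact Real.log_le_log (Real.exp_pos _) h1.le

/-- **The crude level**: `0 ≤ L`, `log D_max ≤ L`, `log(x + h) ≤ L` (`1 ≤ x`, `H ≤ x`, `h ≤ x`, `U₀ ≥ 0`).
[folklore] -/
theorem pp_L {h : ℕ} (hx : 1 ≤ x) (hH : H ≤ x) (hh : h ≤ x) (hU : 0 ≤ ppU ε₀ q x) :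
    0 ≤ ppL ε₀ q x ∧ Real.log (ppDmax ε₀ q x H : ℝ) ≤ ppL ε₀ q x ∧ Real.log ((x + h : ℕ) : ℝ) ≤ ppL ε₀ q x := by
  have hX0 : 0 ≤ Real.log x := Real.log_nonneg (by exact_mod_cast hx)
  have hlogH := pp_log_add_le (x := x) hx hH
  have hlogh := pp_log_add_le (x := x) hx hh
  refine ⟨by unfold ppL; positivity, ?_, by unfold ppL; linarith⟩
  -- `Dmax ≤ E + 1 ≤ 2E` with `E = exp(log(x+H) − X + 2U₀ + 1) ≥ 1`
  set E := Real.exp (Real.log ((x + H : ℕ) : ℝ) - Real.log x + 2 * ppU ε₀ q x + 1) with hE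
  have hE1 : 1 ≤ E := by
    rw [hE]
    refine Real.one_le_exp ?_
    have : Real.log x ≤ Real.log ((x + H : ℕ) : ℝ) :=
      Real.log_le_log (by exact_mod_cast hx) (by exact_mod_cast Nat.le_add_right x H)
    linarith
  have hD : (ppDmax ε₀ q x H : ℝ) ≤ 2 * E := by
    unfold ppDmax
    have := (Nat.ceil_lt_add_one (by positivity : 0 ≤ E)).le
    linarith
  have hDpos : (0 : ℝ) < ppDmax ε₀ q x H := by
    unfold ppDmax; exact_mod_cast Nat.ceil_pos.mpr (by positivity)
  calc Real.log (ppDmax ε₀ q x H : ℝ) ≤ Real.log (2 * E) := Real.log_le_log hDpos hD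
    _ = Real.log 2 + (Real.log ((x + H : ℕ) : ℝ) - Real.log x + 2 * ppU ε₀ q x + 1) := by
        rw [Real.log_mul two_ne_zero (by positivity), hE, Real.log_exp]
    _ ≤ ppL ε₀ q x := by unfold ppL; have := log_two_lt_and_one_lt_log_three.1; linarith

/-- `A = D_max + 1` is admissible: `1 ≤ A` and `D_max < 2^{A+1}`. [folklore] -/
theorem pp_A (D : ℕ) : 1 ≤ D + 1 ∧ D < 2 ^ (D + 1 + 1) :=
  ⟨Nat.le_add_left 1 D, (Nat.lt_two_pow_self).trans (Nat.pow_lt_pow_right (by norm_num) (by omega))⟩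

/-- **The `ζ`-window**: with `τ₀ = X^{−9/10}`, `1/X + 2πτ₀ ≤ 1/(2C₀)` as soon as
`X ≥ 1` and `(2C₀(1 + 2π)) X^{−9/10} ≤ 1`... stated as: `X ≥ 1` and `2C₀(1+2π) ≤ X^{9/10}`. [folklore] -/
theorem pp_small {X C₀ : ℝ} (hX : 1 ≤ X) (hC₀ : 0 < C₀) (hbig : 2 * C₀ * (1 + 2 * π) ≤ X ^ ((9 : ℝ) / 10)) :
    X⁻¹ + 2 * π * X ^ (-(9 : ℝ) / 10) ≤ 1 / (2 * C₀) := by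
  have hX0 : 0 < X := by linarith
  have hτ : X ^ (-(9 : ℝ) / 10) = (X ^ ((9 : ℝ) / 10))⁻¹ := by
    rw [show (-(9 : ℝ) / 10) = -((9 : ℝ) / 10) by ring, Real.rpow_neg hX0.le]
  have hpow_pos : 0 < X ^ ((9 : ℝ) / 10) := Real.rpow_pos_of_pos hX0 _
  have hXle : X ^ ((9 : ℝ) / 10) ≤ X := by
    calc X ^ ((9 : ℝ) / 10) ≤ X ^ (1 : ℝ) := Real.rpow_le_rpow_of_exponent_le hX (by norm_num)
      _ = X := Real.rpow_one X
  have h1 : X⁻¹ ≤ (X ^ ((9 : ℝ) / 10))⁻¹ := inv_anti₀ hpow_pos hXle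
  rw [hτ]
  calc X⁻¹ + 2 * π * (X ^ ((9 : ℝ) / 10))⁻¹ ≤ (X ^ ((9 : ℝ) / 10))⁻¹ + 2 * π * (X ^ ((9 : ℝ) / 10))⁻¹ := by gcongr
    _ = (1 + 2 * π) / X ^ ((9 : ℝ) / 10) := by ring
    _ ≤ (1 + 2 * π) / (2 * C₀ * (1 + 2 * π)) := div_le_div_of_nonneg_left (by positivity) (by positivity) hbig
    _ = 1 / (2 * C₀) := by field_simp

end

end TaoTeravainen

end Literature.Barriers.Parity
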